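import Mathlib
import HarnessLib
import Summits.HubbardSuperconductivity.HubbardSuperconductivity.Theorems.KLProgrammeKLRegimeEngineScaleZeroExplicit

/-!
# K3 engine child (stmt-HubbardSuperconductivity-19855), stub `stub_engine_scale0`, clause (E1-v4)₀: the `β/L/M` cancellation in the
# overlap size `T`

Cell gate-hubbard-kl, seat hubbard-kl-k3c2-p1.  First lemma of the final numeric assembly of (E1-v4)₀ (after
`KLProgrammeKLRegimeEngineScaleZeroExplicit.klAnisoLegKernelNorm_zero_le_explicit`): the product-torus size
`T = (βL²)⁻¹·√(2048(1/s₀ + 1)Φ)·√(16·4M·L²·N_s)` of the scale-`0` overlap kernel, at `s₀ = βe₀/(16πM)` and with the support count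
`N_s ≤ (e₀β/π + 1)(1793e₀L² + 704L)`, is `≤ C_T(Φ)·M/β` with
`C_T(Φ) = √(2048(16π/e₀ + 1)Φ)·√(64·1794e₀·(e₀/π + 1/klBetaMin))` — uniformly in `L ≥ 2^15` and `M ≥ β ≥ klBetaMin`
(so that `T·(2T·β/(2M))^{2p-1} ≤ C_T^{2p}·M/β`, the `M/β` being absorbed by the vertex profile `∝ β/M`).

* **`scaleZero_T_le`**.

Everything is proved; no definitions, no named facts, no sorry.
-/

noncomputable section

namespace Summit.HubbardSuperconductivity.HubbardSuperconductivity.Theorems.EngineV8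

set_option linter.dupNamespace false -- summit = problem name (single-conjunct summit), D-0017

open Real Finset
open Summit.HubbardSuperconductivity.HubbardSuperconductivity.Theorems.KLRegimeSplit
open Summit.HubbardSuperconductivity.HubbardSuperconductivity.Theorems.KLProgrammeLegKernels

/-- **The `β/L/M` cancellation in `T`**: for `klBetaMin ≤ β ≤ M`, `2^15 ≤ L`, `Φ ≥ 0` and a support count
`0 ≤ N_s ≤ (e₀β/π + 1)(1793e₀L² + 704L)`,
`(|β|L²)⁻¹·√(2048(1/(βe₀/(16πM)) + 1)Φ)·√(16·(4M)·L²·N_s) ≤ √(2048(16π/e₀ + 1)Φ)·√(64·(1794e₀)·(e₀/π + 1/klBetaMin))·(M/β)`. -/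
theorem scaleZero_T_le {β : ℝ} {L M : ℕ} (hβ : klBetaMin ≤ β) (hβM : β ≤ M) (hL : (2 : ℝ) ^ 15 ≤ L) {Φ Ns : ℝ}
    (hΦ : 0 ≤ Φ) (hNs0 : 0 ≤ Ns) (hNs : Ns ≤ (klE0 * β / Real.pi + 1) * (1793 * klE0 * (L : ℝ) ^ 2 + 704 * L)) :
    1 / (|β| * (L : ℝ) ^ 2) *
        (Real.sqrt (2048 * (1 / (β * klE0 / (16 * Real.pi * M)) + 1) * Φ) *
          Real.sqrt (16 * (2 * (2 * M) : ℕ) * (L : ℝ) ^ 2 * Ns)) ≤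
      Real.sqrt (2048 * (16 * Real.pi / klE0 + 1) * Φ) *
        Real.sqrt (64 * (1794 * klE0) * (klE0 / Real.pi + 1 / klBetaMin)) * ((M : ℝ) / β) := by
  have he : (0 : ℝ) < klE0 := by norm_num [klE0]
  have hβmin : (0 : ℝ) < klBetaMin := by norm_num [klBetaMin]
  have hβpos : 0 < β := lt_of_lt_of_le hβmin hβ
  have hLpos : (0 : ℝ) < L := lt_of_lt_of_le (by norm_num) hL
  have hMpos : (0 : ℝ) < M := lt_of_lt_of_le hβpos hβM
  have hπ := Real.pi_pos
  have hMβ : 1 ≤ (M : ℝ) / β := by rw [le_div_iff₀ hβpos, one_mul]; exact hβM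
  rw [abs_of_pos hβpos]
  -- the two elementary inequalities
  have h1 : 1 / (β * klE0 / (16 * Real.pi * M)) + 1 ≤ (16 * Real.pi / klE0 + 1) * ((M : ℝ) / β) := by
    have heq : 1 / (β * klE0 / (16 * Real.pi * M)) = 16 * Real.pi / klE0 * ((M : ℝ) / β) := by
      field_simp
    rw [heq, add_mul, one_mul]
    gcongr
  have h2 : Ns ≤ β * (klE0 / Real.pi + 1 / klBetaMin) * (1794 * klE0 * (L : ℝ) ^ 2) := by
    refine hNs.trans ?_
    have h704 : 704 * (L : ℝ) ≤ klE0 * (L : ℝ) ^ 2 := by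
      rw [show klE0 = 1 / 32 by norm_num [klE0]]
      nlinarith
    have hA : 1793 * klE0 * (L : ℝ) ^ 2 + 704 * L ≤ 1794 * klE0 * (L : ℝ) ^ 2 := by linarith
    have hB : klE0 * β / Real.pi + 1 ≤ β * (klE0 / Real.pi + 1 / klBetaMin) := by
      rw [mul_add]
      have : 1 ≤ β * (1 / klBetaMin) := by
        rw [mul_one_div, le_div_iff₀ hβmin, one_mul]; exact hβ
      have : klE0 * β / Real.pi = β * (klE0 / Real.pi) := by ring
      linarith
    calc (klE0 * β / Real.pi + 1) * (1793 * klE0 * (L : ℝ) ^ 2 + 704 * L)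
        ≤ (β * (klE0 / Real.pi + 1 / klBetaMin)) * (1794 * klE0 * (L : ℝ) ^ 2) :=
          mul_le_mul hB hA (by positivity) (by positivity)
      _ = _ := by ring
  -- combine under one square root and compare the radicands
  set X : ℝ := 2048 * (1 / (β * klE0 / (16 * Real.pi * M)) + 1) * Φ * (16 * (2 * (2 * M) : ℕ) * (L : ℝ) ^ 2 * Ns) with hX
  set Y : ℝ := 2048 * (16 * Real.pi / klE0 + 1) * Φ * (64 * (1794 * klE0) * (klE0 / Real.pi + 1 / klBetaMin)) with hY
  have hs0pos : 0 < 1 / (β * klE0 / (16 * Real.pi * M)) + 1 := by positivity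
  have hX0 : 0 ≤ 2048 * (1 / (β * klE0 / (16 * Real.pi * M)) + 1) * Φ := by positivity
  have hY0 : 0 ≤ 2048 * (16 * Real.pi / klE0 + 1) * Φ := by positivity
  have hXY : X ≤ Y * (((M : ℝ) / β) ^ 2 * (β * (L : ℝ) ^ 2) ^ 2) := by
    rw [hX, hY]
    push_cast
    have hNN : 16 * (2 * (2 * (M : ℝ))) * (L : ℝ) ^ 2 * Ns ≤
        16 * (2 * (2 * (M : ℝ))) * (L : ℝ) ^ 2 * (β * (klE0 / Real.pi + 1 / klBetaMin) * (1794 * klE0 * (L : ℝ) ^ 2)) :=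
      mul_le_mul_of_nonneg_left h2 (by positivity)
    have hSS : 2048 * (1 / (β * klE0 / (16 * Real.pi * M)) + 1) * Φ ≤ 2048 * ((16 * Real.pi / klE0 + 1) * ((M : ℝ) / β)) * Φ := by
      gcongr
    calc 2048 * (1 / (β * klE0 / (16 * Real.pi * M)) + 1) * Φ * (16 * (2 * (2 * (M : ℝ))) * (L : ℝ) ^ 2 * Ns)
        ≤ (2048 * ((16 * Real.pi / klE0 + 1) * ((M : ℝ) / β)) * Φ) *
            (16 * (2 * (2 * (M : ℝ))) * (L : ℝ) ^ 2 * (β * (klE0 / Real.pi + 1 / klBetaMin) * (1794 * klE0 * (L : ℝ) ^ 2))) :=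
          mul_le_mul hSS hNN (by positivity) (by positivity)
      _ = 2048 * (16 * Real.pi / klE0 + 1) * Φ * (64 * (1794 * klE0) * (klE0 / Real.pi + 1 / klBetaMin)) *
            (((M : ℝ) / β) ^ 2 * (β * (L : ℝ) ^ 2) ^ 2) := by
          field_simp
          ring
  calc 1 / (β * (L : ℝ) ^ 2) * (Real.sqrt (2048 * (1 / (β * klE0 / (16 * Real.pi * M)) + 1) * Φ) *
        Real.sqrt (16 * (2 * (2 * M) : ℕ) * (L : ℝ) ^ 2 * Ns))
      = 1 / (β * (L : ℝ) ^ 2) * Real.sqrt X := by rw [hX, ← Real.sqrt_mul hX0]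
    _ ≤ 1 / (β * (L : ℝ) ^ 2) * Real.sqrt (Y * (((M : ℝ) / β) ^ 2 * (β * (L : ℝ) ^ 2) ^ 2)) :=
        mul_le_mul_of_nonneg_left (Real.sqrt_le_sqrt hXY) (by positivity)
    _ = Real.sqrt Y * ((M : ℝ) / β) := by
        have hYnn : 0 ≤ Y := by rw [hY]; positivity
        have hprod : Real.sqrt (((M : ℝ) / β) ^ 2 * (β * (L : ℝ) ^ 2) ^ 2) = (M : ℝ) / β * (β * (L : ℝ) ^ 2) := by
          rw [Real.sqrt_mul (pow_nonneg (by positivity) 2) ((β * (L : ℝ) ^ 2) ^ 2), Real.sqrt_sq (by positivity),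
            Real.sqrt_sq (by positivity)]
        rw [Real.sqrt_mul hYnn (((M : ℝ) / β) ^ 2 * (β * (L : ℝ) ^ 2) ^ 2), hprod]
        field_simp
    _ = _ := by rw [hY, Real.sqrt_mul hY0]

end Summit.HubbardSuperconductivity.HubbardSuperconductivity.Theorems.EngineV8

end
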